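import Summits.ResolutionOfSingularities.ResolutionOfSingularities.Theorems.MarkedTransferCampaignW46WWalkNRStep
import Summits.ResolutionOfSingularities.ResolutionOfSingularities.Theorems.MarkedTransferCampaignW46WWalkInseparableChild
import Mathlib.FieldTheory.SeparableClosure
import HarnessLib

/-!
# [OURS · L1 W4.6 rung (iii-2), NON-RATIONAL W-WALK over an ARBITRARY ground field, brick 13] SEPARABLE RESIDUE EXTENSIONS ALONG A THREAD:
# inside o1's regime the residue field of a singular point of the transform is separable over the residue field of the centre

Cell `res-hironaka`, LADDER-RESOLUTION rung L (D-0089), slot W4.6 rung (iii); seat res-L1-s46-pv-6 (gen 8). Host route MarkedTransfer,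
`--supports stmt-ResolutionOfSingularities-16155 --as helper`; kind proof (def-free). IMPERFECT-`K` ROAD (res-L1-s46-pv-5's `W-WALK-PLAN.md`
§7.2 (b)→(c)): the BRIDGE from res-L1-s46-pv-5's ring-level `WWalk.false_of_inseparable_child` (p577683: an inseparable child is never in the
window) to the separability INPUT of this seat's separable `w`-step (`…WWalkNRHensel`, `…WWalkNRStepCoreSep`, `…WWalkNRStepSep`).

WHAT.
* `isSeparable_of_generator`, `separable_of_irreducible_of_isSeparable` (field theory): if `F = κ[ȳ]` with `ȳ` a root of a separable
  polynomial, every element of `F` is separable over `κ` (`κ⟮ȳ⟯ ≤ separableClosure`), and an irreducible polynomial with a separable root is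
  separable (it is the minimal polynomial up to a unit).
* `separable_map_residue_of_root` (ring level, `g : R → L` local): if every element of `L` is an `R`-polynomial in `e_y` modulo `𝔪_L` and `e_y`
  is a root modulo `𝔪_L` of some `π̃ ∈ R[X]` with SEPARABLE reduction, then every `ρ̃ ∈ R[X]` with irreducible reduction and a root in `L` modulo
  `𝔪_L` has separable reduction.
* `separable_map_residue_of_window_child` (scheme level — THE BRIDGE): `π` the blow-up of an ambient datum at the reduced closed point
  `ξ = π(ξ′)`, `E.b = p`, `J_ξ = (z^p + Σ_{j ≤ d} a_j x^{d−j} y^j)` a COEFFICIENT window germ (o1's `MohWindowSurfaceCoeffAt`: `p < d < 2p`, a unit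
  among the `a_j`), `ξ′ ∈ Sing(E′)` with `J′_{ξ′}` again a window germ (`MohWindowSurfaceAt`). THEN every `ρ̃ ∈ 𝒪_{Z,ξ}[X]` with irreducible
  reduction acquiring a root in `𝒪_{Z′,ξ′}` modulo `𝔪_{ξ′}` has separable reduction. Proof: read `J` in the regime's r.s.p. `(x, y, z)`; the
  Rees-algebra chart data at `ξ′` (gen 7 brick 4 `exists_stalk_chartData_nr`) are a `u`-chart (the `z`-chart origin is a unit point,
  `false_of_zChart_nr`) at a point `𝔪_{ξ′} = (t, e_z, π̃^{π♯}(e))`; the chart identity `π♯(z^p + Σ a_j x^{d−j} y^j) = t^p (e_z^p + t^{d−p} P̃^{π♯}(e))`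
  (`sum_chart_x` / `sum_chart_y`, `P̃ = Σ a_j X^j` resp. `Σ a_{d−j} X^j`) identifies the generator of `J′_{ξ′}` with pv-5's `f′`; the window at
  `ξ′` gives `u f′ − z′^p ∈ 𝔪^{p+1}`; so if `π̃` had inseparable reduction, `false_of_inseparable_child` would fire. Hence the minimal polynomial of
  the point is separable, and `separable_map_residue_of_root` spreads this to the whole residue extension.

HONEST FRAMING. OURS; NOT a statement of H. Hironaka's manuscript [Hironaka2017]; nothing of it is used. AI-written; AI review is weaker
than expert review. No `sorry`; axioms standard. References: H. Matsumura, *Commutative Ring Theory* (1986) Thm. 16.2 [Matsumura1987];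
H. Hauser, Bull. AMS 47 (2010) §§F–G [Hauser2010]; Stacks Project Tag 0804 (affine blow-up algebra) [StacksProject]; Tag 09H1 (separable
elements). [folklore]
-/

noncomputable section

set_option linter.dupNamespace false -- mandated namespace of this single-conjunct summit

open IsLocalRing Polynomial
open scoped IntermediateField

namespace Summit.ResolutionOfSingularities.ResolutionOfSingularities.Theorems

namespace CampaignW46

namespace WWalkNR

/-! ## §1 Field theory: one separable generator makes the extension separable -/

section FieldTheory

variable {κ F : Type*} [Field κ] [Field F] [Algebra κ F]

/-- If `F = κ[ȳ]` with `ȳ` a root of an irreducible SEPARABLE polynomial over `κ`, every element of `F` is separable over `κ`. [folklore] -/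
theorem isSeparable_of_generator {y : F} {π : κ[X]} (hsep : π.Separable) (hy : aeval y π = 0) (z : F)
    (hz : ∃ P : κ[X], z = aeval y P) : IsSeparable κ z := by
  have hysep : IsSeparable κ y := Polynomial.Separable.of_dvd hsep (minpoly.dvd κ y hy)
  obtain ⟨P, rfl⟩ := hz
  have hmem : aeval y P ∈ κ⟮y⟯ := IntermediateField.algebra_adjoin_le_adjoin κ {y} (Polynomial.aeval_mem_adjoin_singleton κ y)
  have h1 : κ⟮y⟯ ≤ separableClosure κ F := IntermediateField.adjoin_simple_le_iff.mpr (mem_separableClosure_iff.mpr hysep)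
  exact mem_separableClosure_iff.mp (h1 hmem)

/-- An irreducible polynomial with a separable root is separable. [folklore] -/
theorem separable_of_irreducible_of_isSeparable {z : F} (hz : IsSeparable κ z) {ρ : κ[X]} (hirr : Irreducible ρ) (hρ : aeval z ρ = 0) :
    ρ.Separable := by
  have h := minpoly.eq_of_irreducible hirr hρ
  have h2 : (ρ * C ρ.leadingCoeff⁻¹).Separable := by rw [h]; exact hz
  exact h2.of_mul_left

end FieldTheory

/-! ## §2 Ring level: residues -/

section Residue

variable {R L : Type*} [CommRing R] [IsLocalRing R] [CommRing L] [IsLocalRing L] (g : R →+* L) [IsLocalHom g]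

/-- **Separability of the residue field extension from ONE separable generator** (ring level). If every element of `L` is an `R`-polynomial
in `e_y` modulo `𝔪_L` and `e_y` is a root modulo `𝔪_L` of a polynomial `π̃ ∈ R[X]` with SEPARABLE reduction, then every monic `ρ̃ ∈ R[X]` with
irreducible reduction having a root `y ∈ L` modulo `𝔪_L` has separable reduction (the residue field of `L` is separable over that of `R`).
[folklore] -/
theorem separable_map_residue_of_root (ey : L) (hres : ∀ c : L, ∃ P : R[X], c - (P.map g).eval ey ∈ maximalIdeal L)
    (πR : R[X]) (hsep : (πR.map (residue R)).Separable) (hπ : (πR.map g).eval ey ∈ maximalIdeal L)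
    (ρR : R[X]) (hρirr : Irreducible (ρR.map (residue R))) (y : L) (hρ : (ρR.map g).eval y ∈ maximalIdeal L) :
    (ρR.map (residue R)).Separable := by
  letI : Algebra (ResidueField R) (ResidueField L) := (ResidueField.map g).toAlgebra
  have hres_eval : ∀ (T : R[X]) (x : L), residue L ((T.map g).eval x) = aeval (residue L x) (T.map (residue R)) := fun T x => by
    rw [Polynomial.eval_map, Polynomial.hom_eval₂, Polynomial.aeval_def, Polynomial.eval₂_map]
    rfl
  have hy0 : aeval (residue L ey) (πR.map (residue R)) = 0 := by
    rw [← hres_eval, residue_eq_zero_iff]; exact hπ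
  have hz : ∃ P : (ResidueField R)[X], residue L y = aeval (residue L ey) P := by
    obtain ⟨P, hP⟩ := hres y
    refine ⟨P.map (residue R), ?_⟩
    rw [← hres_eval, ← sub_eq_zero, ← map_sub, residue_eq_zero_iff]
    exact hP
  have hsepy : IsSeparable (ResidueField R) (residue L y) := isSeparable_of_generator hsep hy0 _ hz
  have hρ0 : aeval (residue L y) (ρR.map (residue R)) = 0 := by
    rw [← hres_eval, residue_eq_zero_iff]; exact hρ
  exact separable_of_irreducible_of_isSeparable hsepy hρirr hρ0

end Residue

/-! ## §2b Chart sums -/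

section Sums

variable {L : Type*} [CommRing L]

/-- `Σ_{j ≤ d} a_j t^{d−j} (t ε)^j = t^d · Σ_{j ≤ d} a_j ε^j` (reading `Σ a_j x^{d−j} y^j` in the `x`-chart). [cite: Hauser2010, §F] -/
theorem sum_chart_x (a : ℕ → L) (t ε : L) (d : ℕ) :
    ∑ j ∈ Finset.range (d + 1), a j * t ^ (d - j) * (t * ε) ^ j = t ^ d * ∑ j ∈ Finset.range (d + 1), a j * ε ^ j := by
  rw [Finset.mul_sum]
  refine Finset.sum_congr rfl fun j hj => ?_
  have hjd : j ≤ d := Nat.lt_succ_iff.mp (Finset.mem_range.mp hj)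
  have ht : t ^ d = t ^ (d - j) * t ^ j := by rw [← pow_add, Nat.sub_add_cancel hjd]
  rw [mul_pow, ht]; ring

/-- `Σ_{j ≤ d} a_j (t ε)^{d−j} t^j = t^d · Σ_{j ≤ d} a_{d−j} ε^j` (reading `Σ a_j x^{d−j} y^j` in the `y`-chart). [cite: Hauser2010, §F] -/
theorem sum_chart_y (a : ℕ → L) (t ε : L) (d : ℕ) :
    ∑ j ∈ Finset.range (d + 1), a j * (t * ε) ^ (d - j) * t ^ j = t ^ d * ∑ j ∈ Finset.range (d + 1), a (d - j) * ε ^ j := by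
  have hrefl : ∑ j ∈ Finset.range (d + 1), a (d - j) * ε ^ j = ∑ j ∈ Finset.range (d + 1), a j * ε ^ (d - j) := by
    have h := Finset.sum_range_reflect (fun j => a j * ε ^ (d - j)) (d + 1)
    simp only [Nat.add_sub_cancel] at h
    rw [← h]
    refine Finset.sum_congr rfl fun j hj => ?_
    have hjd : j ≤ d := Nat.lt_succ_iff.mp (Finset.mem_range.mp hj)
    rw [Nat.sub_sub_self hjd]
  rw [hrefl, Finset.mul_sum]
  refine Finset.sum_congr rfl fun j hj => ?_
  have hjd : j ≤ d := Nat.lt_succ_iff.mp (Finset.mem_range.mp hj)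
  have ht : t ^ d = t ^ (d - j) * t ^ j := by rw [← pow_add, Nat.sub_add_cancel hjd]
  rw [mul_pow, ht]; ring

/-- Evaluating the coefficient polynomial `Σ_{j ≤ d} C(b_j) X^j` under a ring map. [folklore] -/
theorem eval_map_coeffPoly {R : Type*} [CommRing R] (g : R →+* L) (b : ℕ → R) (d : ℕ) (ε : L) :
    ((∑ j ∈ Finset.range (d + 1), C (b j) * X ^ j).map g).eval ε = ∑ j ∈ Finset.range (d + 1), g (b j) * ε ^ j := by
  rw [Polynomial.map_sum, Polynomial.eval_finsetSum]
  refine Finset.sum_congr rfl fun j _ => ?_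
  rw [Polynomial.map_mul, Polynomial.map_C, Polynomial.map_pow, Polynomial.map_X, Polynomial.eval_mul, Polynomial.eval_C,
    Polynomial.eval_pow, Polynomial.eval_X]

/-- The coefficient polynomial has degree `≤ d`. [folklore] -/
theorem natDegree_coeffPoly_le {R : Type*} [CommRing R] (b : ℕ → R) (d : ℕ) :
    (∑ j ∈ Finset.range (d + 1), C (b j) * X ^ j).natDegree ≤ d :=
  Polynomial.natDegree_sum_le_of_forall_le _ _ fun j hj =>
    (Polynomial.natDegree_C_mul_X_pow_le (b j) j).trans (Nat.lt_succ_iff.mp (Finset.mem_range.mp hj))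

/-- The reduction of the coefficient polynomial is nonzero as soon as one `b_k`, `k ≤ d`, is a unit. [folklore] -/
theorem map_coeffPoly_ne_zero {R : Type*} [CommRing R] [IsLocalRing R] (b : ℕ → R) (d k : ℕ) (hk : k ≤ d) (hu : IsUnit (b k)) :
    (∑ j ∈ Finset.range (d + 1), C (b j) * X ^ j).map (residue R) ≠ 0 := by
  intro h
  have hc := congrArg (fun P : (ResidueField R)[X] => P.coeff k) h
  simp only [Polynomial.map_sum, Polynomial.map_mul, Polynomial.map_C, Polynomial.map_pow, Polynomial.map_X, Polynomial.finsetSum_coeff,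
    Polynomial.coeff_C_mul_X_pow, Polynomial.coeff_zero] at hc
  rw [Finset.sum_eq_single k (fun j _ hjk => if_neg (Ne.symm hjk)) (fun hk' => absurd (Finset.mem_range.mpr (Nat.lt_succ_of_le hk)) hk'),
    if_pos rfl, residue_eq_zero_iff] at hc
  exact (mem_maximalIdeal _).mp hc hu

end Sums

/-! ## §3 Inside the regime, the residue field of a singular point of the transform is separable over that of the centre -/

section Scheme

open CategoryTheory AlgebraicGeometry TopologicalSpace
open Literature.AlgebraicGeometry.Hironaka2017.S02Preliminaries
open Literature.AlgebraicGeometry.Hironaka2017.Datum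
open Literature.AlgebraicGeometry.Resolution
open Scheme.IdealSheafData
open WWalk
open MohWindowShadeFormalNR (exists_stalk_chartData_nr e_mem_maximalIdeal_of_transform false_of_zChart_nr)
open CampaignW46.FormalChart
open CampaignW46.ChartPoint
open MohWindowShadeFormalStep (exists_other_index)

variable {p : ℕ} [hp : Fact p.Prime] {K : Type} [Field K] [CharP K p]

/-- [OURS · L1 W4.6 rung (iii-2), imperfect-`K` road] **SEPARABLE RESIDUE EXTENSIONS ALONG A THREAD.** Let `π` be the blow-up of an ambient datum
at the reduced closed point `ξ = π(ξ′)`, `E.b = p`, the stalk `J_ξ` a COEFFICIENT window germ `z^p + Σ_{j ≤ d} a_j x^{d−j} y^j` (`p < d < 2p`, some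
`a_j` a unit: o1's `MohWindowSurfaceCoeffAt`), `ξ′ ∈ Sing(E′)` and the stalk `J′_{ξ′}` of the transform again a window germ (`MohWindowSurfaceAt`).
THEN every `ρ̃ ∈ 𝒪_{Z,ξ}[X]` with irreducible reduction that acquires a root in `𝒪_{Z′,ξ′}` modulo `𝔪_{ξ′}` has SEPARABLE reduction — the
residue field `κ(ξ′)` is separable over `κ(ξ)`. (Read the germ in the chart delivered by the Rees algebra: `f′ = e_z^p + t^{d−p} P̃^{π♯}(e)`; if the
minimal polynomial of the point were inseparable, res-L1-s46-pv-5's `WWalk.false_of_inseparable_child` would contradict the window at `ξ′`; a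
separable generator makes the whole residue extension separable.) NOT a statement of the manuscript. [cite: Matsumura1987, Thm. 16.2]
[cite: Hauser2010, §§F–G] [cite: StacksProject, Tag 0804] -/
theorem separable_map_residue_of_window_child {A A' : AmbientDatum p K} (π : A'.Z ⟶ A.Z) (D : Closeds A.Z)
    (hπ : IsBlowup π (vanishingIdeal D)) {E : IdealExponent A.Z} (hb : E.b = p) {ξ' : A'.Z} (hD : (D : Set A.Z) = {π.base ξ'})
    (hcoef : MohWindowSurfaceCoeffAt p (A.Z.presheaf.stalk (π.base ξ')) (stalkIdeal E.J (π.base ξ')))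
    (hξ' : ξ' ∈ (E.transform π D).sing)
    (hwin' : MohWindowSurfaceAt p (A'.Z.presheaf.stalk ξ') (stalkIdeal (E.transform π D).J ξ'))
    (ρR : Polynomial (A.Z.presheaf.stalk (π.base ξ'))) (hρirr : Irreducible (ρR.map (residue _)))
    (yL : A'.Z.presheaf.stalk ξ') (hρy : (ρR.map (π.stalkMap ξ').hom).eval yL ∈ maximalIdeal _) :
    (ρR.map (residue _)).Separable := by
  classical
  haveI : IsLocallyNoetherian A'.Z := ambient_isLocallyNoetherian A'
  obtain ⟨hR, h3, x, yy, z, hxyz, d, a, hpd, hd2, ⟨j₀, hj₀, hunit⟩, hI⟩ := hcoef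
  obtain ⟨hR', h3', x', y', z', hxyz', d', f'', hpd', -, hf''mem, -, hI'⟩ := hwin'
  haveI := hR
  haveI := hR'
  haveI : IsDomain (A'.Z.presheaf.stalk ξ') := isDomain_of_isRegularLocalRing _
  -- characteristic `p` of the stalks and of the residue field downstairs
  haveI : CharP (A'.Z.presheaf.stalk ξ') p := by
    let φ : K →+* (A'.Z.presheaf.stalk ξ' : CommRingCat) :=
      (A'.Z.presheaf.germ ⊤ ξ' trivial).hom.comp (A'.hom.appTop.hom.comp (Scheme.ΓSpecIso (.of K)).inv.hom)
    exact charP_of_injective_ringHom φ.injective p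
  haveI : CharP (A.Z.presheaf.stalk (π.base ξ')) p := by
    let φ : K →+* (A.Z.presheaf.stalk (π.base ξ') : CommRingCat) :=
      (A.Z.presheaf.germ ⊤ (π.base ξ') trivial).hom.comp (A.hom.appTop.hom.comp (Scheme.ΓSpecIso (.of K)).inv.hom)
    exact charP_of_injective_ringHom φ.injective p
  haveI : CharP (ResidueField (A.Z.presheaf.stalk (π.base ξ'))) p :=
    (CharP.charP_iff_prime_eq_zero hp.out).mpr (by
      rw [← map_natCast (residue (A.Z.presheaf.stalk (π.base ξ'))), CharP.cast_eq_zero, map_zero])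
  -- the regime's regular system of parameters as chart coordinates: `c z = z`, `c u₀ = x`, `c u₁ = y`
  set c : Option (Fin 2) → A.Z.presheaf.stalk (π.base ξ') := fun o => Option.elim o z (fun i => if i = 0 then x else yy) with hcdef
  have hcz : c none = z := rfl
  have hcx : c (some 0) = x := by rw [hcdef]; simp
  have hcy : c (some 1) = yy := by rw [hcdef]; simp
  have hc : Ideal.span (Set.range c) = maximalIdeal (A.Z.presheaf.stalk (π.base ξ')) := by
    rw [← hxyz]
    apply le_antisymm
    · rw [Ideal.span_le]
      rintro _ ⟨o, rfl⟩
      rcases o with _ | i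
      · rw [SetLike.mem_coe, hcz]; exact Ideal.subset_span (by simp)
      · rcases i with ⟨_ | _ | k, hk⟩
        · rw [SetLike.mem_coe, show c (some ⟨0, hk⟩) = x from hcx]; exact Ideal.subset_span (by simp)
        · rw [SetLike.mem_coe, show c (some ⟨1, hk⟩) = yy from hcy]; exact Ideal.subset_span (by simp)
        · omega
    · rw [Ideal.span_le]
      intro t ht
      simp only [Set.mem_insert_iff, Set.mem_singleton_iff] at ht
      rw [SetLike.mem_coe]
      rcases ht with rfl | rfl | rfl
      · rw [← hcx]; exact Ideal.subset_span ⟨some 0, rfl⟩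
      · rw [← hcy]; exact Ideal.subset_span ⟨some 1, rfl⟩
      · exact Ideal.subset_span ⟨none, rfl⟩
  have hcl : IsClosed ({π.base ξ'} : Set A.Z) := hD ▸ D.isClosed
  have hcJ : Ideal.span (Set.range c) = stalkIdeal (vanishingIdeal D) (π.base ξ') := by
    rw [hc, stalkIdeal_vanishingIdeal_eq_maximalIdeal_of_closure_eq]
    rw [hD, hcl.closure_eq]
  have hd3 : (maximalIdeal (A.Z.presheaf.stalk (π.base ξ'))).spanFinrank = Fintype.card (Option (Fin 2)) := by rw [h3]; simp
  have hdimL : ringKrullDim (A'.Z.presheaf.stalk ξ') = Fintype.card (Option (Fin 2)) := by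
    have h := IsRegularLocalRing.spanFinrank_maximalIdeal (R := A'.Z.presheaf.stalk ξ')
    rw [h3'] at h; rw [← h]; simp
  obtain ⟨i, e, he, hei, hnzd, hNoeth, hcont⟩ := exists_stalk_chartData_nr hπ ξ' c hcJ hc hd3 hdimL
  haveI := hNoeth
  set g := (π.stalkMap ξ').hom with hgdef
  have hloc : IsLocalHom g := inferInstance
  have hg : (maximalIdeal (A.Z.presheaf.stalk (π.base ξ'))).map g ≤ maximalIdeal (A'.Z.presheaf.stalk ξ') :=
    ((IsLocalRing.local_hom_TFAE g).out 0 2).mp hloc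
  -- the generator `f₀ = z^p + S` and its transform
  have hx𝔪 : x ∈ maximalIdeal (A.Z.presheaf.stalk (π.base ξ')) := by rw [← hxyz]; exact Ideal.subset_span (by simp)
  have hy𝔪 : yy ∈ maximalIdeal (A.Z.presheaf.stalk (π.base ξ')) := by rw [← hxyz]; exact Ideal.subset_span (by simp)
  have hz𝔪 : z ∈ maximalIdeal (A.Z.presheaf.stalk (π.base ξ')) := by rw [← hxyz]; exact Ideal.subset_span (by simp)
  set S := ∑ j ∈ Finset.range (d + 1), a j * x ^ (d - j) * yy ^ j with hS
  have hS𝔪 : S ∈ maximalIdeal (A.Z.presheaf.stalk (π.base ξ')) ^ d := by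
    refine Ideal.sum_mem _ fun j hj => ?_
    have hjd : j ≤ d := Nat.lt_succ_iff.mp (Finset.mem_range.mp hj)
    have h1 : x ^ (d - j) * yy ^ j ∈ maximalIdeal (A.Z.presheaf.stalk (π.base ξ')) ^ d := by
      have h2 := Ideal.mul_mem_mul (Ideal.pow_mem_pow hx𝔪 (d - j)) (Ideal.pow_mem_pow hy𝔪 j)
      rwa [← pow_add, Nat.sub_add_cancel hjd] at h2
    rw [mul_assoc]
    exact Ideal.mul_mem_left _ _ h1
  set f₀ := z ^ p + S with hf₀
  have hJ : stalkIdeal E.J (π.base ξ') = Ideal.span {f₀} := hI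
  have hf₀u : f₀ - 1 * c none ^ p ∈ maximalIdeal (A.Z.presheaf.stalk (π.base ξ')) ^ (p + 1) := by
    rw [hcz, one_mul, hf₀, add_sub_cancel_left]
    exact Ideal.pow_le_pow_right (by omega) hS𝔪
  have hf₀𝔪 : f₀ ∈ maximalIdeal (A.Z.presheaf.stalk (π.base ξ')) ^ p :=
    Ideal.add_mem _ (Ideal.pow_mem_pow hz𝔪 p) (Ideal.pow_le_pow_right (by omega) hS𝔪)
  obtain ⟨f', hf'⟩ := exists_eq_pow_mul_of_mem_pow g c hc i e he hf₀𝔪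
  have hJ' : stalkIdeal (E.transform π D).J ξ' = Ideal.span {f'} :=
    stalkIdeal_transform_eq_span hπ ξ' c hcJ i e he hnzd E f₀ hJ f' (by rw [hb]; exact hf')
  have hf'𝔪 : f' ∈ maximalIdeal (A'.Z.presheaf.stalk ξ') ^ p := by
    have h := (mem_sing_transform_iff E ξ' f' hJ').mp hξ'
    rwa [hb] at h
  have hf'𝔪1 : f' ∈ maximalIdeal (A'.Z.presheaf.stalk ξ') := Ideal.pow_le_self hp.out.ne_zero hf'𝔪
  -- the window at `ξ′`: `v f′ − z′^p ∈ 𝔪^{p+1}`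
  have hwin : ∃ v w : A'.Z.presheaf.stalk ξ', IsUnit v ∧ v * f' - w ^ p ∈ maximalIdeal (A'.Z.presheaf.stalk ξ') ^ (p + 1) := by
    have hass : Associated f' (z' ^ p + f'') := Ideal.span_singleton_eq_span_singleton.mp (hJ'.symm.trans hI')
    obtain ⟨u, hu⟩ := hass
    refine ⟨u, z', u.isUnit, ?_⟩
    rw [mul_comm, hu, add_sub_cancel_left]
    have hxy : Ideal.span {x', y'} ≤ maximalIdeal (A'.Z.presheaf.stalk ξ') := by
      rw [← hxyz', Ideal.span_le]
      intro t ht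
      simp only [Set.mem_insert_iff, Set.mem_singleton_iff] at ht
      rcases ht with rfl | rfl <;> exact Ideal.subset_span (by simp)
    exact Ideal.pow_le_pow_right (by omega) (Ideal.pow_right_mono hxy d' hf''mem)
  -- the chart delivered by the Rees algebra is a `u`-chart
  cases i with
  | none => exact (false_of_zChart_nr c hc g hg e he hnzd isUnit_one hf₀u f' hf' hf'𝔪1).elim
  | some i₀ =>
    have hez : e none ∈ maximalIdeal (A'.Z.presheaf.stalk ξ') :=
      e_mem_maximalIdeal_of_transform c hc g hg e he hnzd isUnit_one hf₀u f' hf' hf'𝔪1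
    obtain ⟨i₁, hi, htwo⟩ := exists_other_index i₀
    have hall : ∀ j : Option (Fin 2), j = some i₀ ∨ j = some i₁ ∨ j = none := by
      intro j
      cases j with
      | none => exact Or.inr (Or.inr rfl)
      | some l => rcases htwo l with rfl | rfl <;> simp
    obtain ⟨πR, hm, hirr, hgen, hres⟩ := hcont (some i₁) none (fun h => hi (Option.some_injective _ h)) (Option.some_ne_none i₀).symm
      (Option.some_ne_none i₁) hall hez
    have hπy : (πR.map g).eval (e (some i₁)) ∈ maximalIdeal (A'.Z.presheaf.stalk ξ') := by
      rw [← hgen]; exact Ideal.subset_span (by simp)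
    -- the coefficient polynomial of the chart and the chart identity `g f₀ = t^p · (e_z^p + t^{d−p} P̃^g(e))`
    set b : ℕ → A.Z.presheaf.stalk (π.base ξ') := if i₀ = 0 then a else fun j => a (d - j) with hbdef
    set P : Polynomial (A.Z.presheaf.stalk (π.base ξ')) := ∑ j ∈ Finset.range (d + 1), C (b j) * X ^ j with hPdef
    set fc := e none ^ p + g (c (some i₀)) ^ (d - p) * (P.map g).eval (e (some i₁)) with hfc
    have hgS : g S = g (c (some i₀)) ^ d * (P.map g).eval (e (some i₁)) := by
      rw [hPdef, eval_map_coeffPoly, hS, map_sum]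
      simp only [map_mul, map_pow]
      by_cases h0 : i₀ = 0
      · subst h0
        have h1 : i₁ = 1 := by
          rcases i₁ with ⟨_ | _ | k, hk⟩
          · exact absurd rfl hi
          · rfl
          · omega
        subst h1
        rw [hbdef, if_pos rfl, ← hcx, ← hcy, he (some 1)]
        exact sum_chart_x (fun j => g (a j)) (g (c (some 0))) (e (some 1)) d
      · have h1 : i₀ = 1 := by
          rcases i₀ with ⟨_ | _ | k, hk⟩
          · exact absurd rfl h0
          · rfl
          · omega
        subst h1
        have h0' : i₁ = 0 := by
          rcases i₁ with ⟨_ | _ | k, hk⟩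
          · rfl
          · exact absurd rfl hi
          · omega
        subst h0'
        rw [hbdef, if_neg (by decide), ← hcx, ← hcy, he (some 0)]
        exact sum_chart_y (fun j => g (a j)) (g (c (some 1))) (e (some 0)) d
    have hident : g f₀ = g (c (some i₀)) ^ p * fc := by
      rw [hf₀, map_add, map_pow, ← hcz, he none, hgS, hfc, mul_pow, mul_add, ← mul_assoc, ← pow_add, Nat.add_sub_cancel' (by omega : p ≤ d)]
    have hff : f' = fc := (mul_cancel_left_mem_nonZeroDivisors (pow_mem hnzd p)).mp (hf'.symm.trans hident)
    -- `P̃` has degree `≤ d` and nonzero reduction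
    have hPd : P.natDegree ≤ d := natDegree_coeffPoly_le b d
    have hP0 : P.map (residue _) ≠ 0 := by
      by_cases h0 : i₀ = 0
      · exact map_coeffPoly_ne_zero b d j₀ hj₀ (by rw [hbdef, if_pos h0]; exact hunit)
      · refine map_coeffPoly_ne_zero b d (d - j₀) (Nat.sub_le d j₀) ?_
        rw [hbdef, if_neg h0]; dsimp only; rw [Nat.sub_sub_self hj₀]; exact hunit
    -- separability of the minimal polynomial of the point: the inseparable case is pv-5's contradiction
    have hsepπ : (πR.map (residue _)).Separable := by
      rw [Polynomial.separable_iff_derivative_ne_zero hirr]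
      intro hder
      exact false_of_inseparable_child g hg c hc e he πR hm hirr hgen h3' hder P hP0 hPd (by omega) (by omega) fc hfc (hff ▸ hf'𝔪)
        (hff ▸ hwin)
    exact separable_map_residue_of_root g (e (some i₁)) hres πR hsepπ hπy ρR hρirr yL hρy

end Scheme

end WWalkNR

end CampaignW46

end Summit.ResolutionOfSingularities.ResolutionOfSingularities.Theorems

end
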